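import Mathlib.MeasureTheory.Integral.Bochner.Basic
import Mathlib.MeasureTheory.Integral.Bochner.Set
import Mathlib.MeasureTheory.Function.L1Space.Integrable
import Mathlib.MeasureTheory.Measure.Typeclasses.Probability
import Mathlib.Data.Real.ConjExponents
import HarnessLib

/-!
# The Paley–Zygmund inequality in Hölder form (moment of order `p > 1`), real-valued

Topic: probability / moments. Companion of `PaleyZygmund.lean` (the `ℝ≥0∞`, second-moment form).
For a measurable `Z ≥ 0` on a probability space with `Z^p` integrable, `p, q` Hölder conjugate
(`p⁻¹ + q⁻¹ = 1`, `1 < p`) and a level `0 ≤ a`: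

* `integral_sub_le_rpow_mul_measureReal_rpow` — the tail Hölder bound
  `∫ Z - a ≤ (∫ Z^p)^{1/p} · P{a < Z}^{1/q}` (from `Z ≤ a + Z · 1{a < Z}` and Hölder's inequality,
  Mathlib `integral_mul_le_Lp_mul_Lq_of_nonneg`);
* `paleyZygmund_rpow` — for `a ≤ ∫ Z`, `((∫ Z - a) / (∫ Z^p)^{1/p})^q ≤ P{a < Z}`; with `a = θ ∫ Z`
  this is the Paley–Zygmund inequality with a moment of order `p`,
  `P(Z > θ E Z) ≥ ((1-θ) E Z / ‖Z‖_p)^{p/(p-1)}` — the second-moment method when only a moment of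
  order `p ∈ (1, 2)` is finite (heavy tails).

Bochner-integral (real) statements with an integrability hypothesis on `Z^p`, for direct use with
`Integrable` data. Not here: the `ℝ≥0∞` form, vector-valued variants.

## References

* R. E. A. C. Paley, A. Zygmund, *A note on analytic functions in the unit circle*, Proc. Camb.
  Phil. Soc. 28 (1932) 266–272 (the case `p = 2`).
* J.-P. Kahane, *Some Random Series of Functions*, 2nd ed., CUP (1985), Ch. I §6, Inequality II.
-/

noncomputable section

open Set Filter Function
open _root_.MeasureTheory
open scoped ENNReal NNReal

namespace Literature.Probability.Moments

variable {Ω : Type*} {mΩ : MeasurableSpace Ω} {P : Measure Ω}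

/-- **Hölder bound for the tail part.** On a probability space, for a measurable `Z ≥ 0` with `Z^p`
integrable, `p, q` Hölder conjugate and a level `a ≥ 0`:
`∫ Z - a ≤ (∫ Z^p)^{1/p} · P{a < Z}^{1/q}`.
Proof: `Z ≤ a + Z · 1{a < Z}` pointwise, and Hölder `∫ Z · 1_E ≤ ‖Z‖_p ‖1_E‖_q = ‖Z‖_p P(E)^{1/q}`.
[folklore] -/
theorem integral_sub_le_rpow_mul_measureReal_rpow [IsProbabilityMeasure P] {Z : Ω → ℝ}
    (hZ0 : ∀ ω, 0 ≤ Z ω) (hZm : Measurable Z) {p q : ℝ} (hpq : p.HolderConjugate q)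
    (hZp : Integrable (fun ω => Z ω ^ p) P) {a : ℝ} (ha : 0 ≤ a) :
    ∫ ω, Z ω ∂P - a ≤ (∫ ω, Z ω ^ p ∂P) ^ (1 / p) * P.real {ω | a < Z ω} ^ (1 / q) := by
  have hp1 : 1 < p := hpq.lt
  have hp0 : 0 < p := hpq.pos
  have hq0 : 0 < q := hpq.symm.pos
  have hE : MeasurableSet {ω | a < Z ω} := measurableSet_lt measurable_const hZm
  -- the indicator `g = 1{a < Z}`
  set g : Ω → ℝ := {ω | a < Z ω}.indicator (fun _ => (1 : ℝ)) with hg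
  have hgm : Measurable g := measurable_const.indicator hE
  have hg01 : ∀ ω, g ω = 0 ∨ g ω = 1 := fun ω => by
    by_cases h : ω ∈ {ω | a < Z ω}
    · exact Or.inr (indicator_of_mem h _)
    · exact Or.inl (indicator_of_notMem h _)
  have hg0 : ∀ ω, 0 ≤ g ω := fun ω => by rcases hg01 ω with h | h <;> simp [h]
  have hg1 : ∀ ω, g ω ≤ 1 := fun ω => by rcases hg01 ω with h | h <;> simp [h]
  -- `Z ∈ L^p`, `g ∈ L^q`
  have hZLp : MemLp Z (ENNReal.ofReal p) P := by
    rw [← integrable_norm_rpow_iff hZm.aestronglyMeasurable (ENNReal.ofReal_pos.2 hp0).ne'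
      ENNReal.ofReal_ne_top, ENNReal.toReal_ofReal hp0.le]
    refine hZp.congr (Eventually.of_forall fun ω => ?_)
    simp [Real.norm_eq_abs, abs_of_nonneg (hZ0 ω)]
  have hgLq : MemLp g (ENNReal.ofReal q) P :=
    MemLp.of_bound hgm.aestronglyMeasurable 1 (Eventually.of_forall fun ω => by
      rw [Real.norm_eq_abs, abs_of_nonneg (hg0 ω)]; exact hg1 ω)
  -- Hölder
  have hH := integral_mul_le_Lp_mul_Lq_of_nonneg hpq (Eventually.of_forall hZ0)
    (Eventually.of_forall hg0) hZLp hgLq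
  -- `∫ g^q = P(a < Z)`
  have hgq : ∫ ω, g ω ^ q ∂P = P.real {ω | a < Z ω} := by
    have : (fun ω => g ω ^ q) = g := by
      funext ω
      rcases hg01 ω with h | h
      · rw [h, Real.zero_rpow hq0.ne']
      · rw [h, Real.one_rpow]
    rw [this, hg, integral_indicator_const _ hE, smul_eq_mul, mul_one]
  -- `∫ Z ≤ a + ∫ Z g`
  have hZi : Integrable Z P := hZLp.integrable (by
    rw [← ENNReal.ofReal_one]; exact ENNReal.ofReal_le_ofReal hp1.le)
  have hZgi : Integrable (fun ω => Z ω * g ω) P :=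
    hZi.mono (hZm.mul hgm).aestronglyMeasurable (Eventually.of_forall fun ω => by
      rw [Real.norm_eq_abs, Real.norm_eq_abs, abs_of_nonneg (mul_nonneg (hZ0 ω) (hg0 ω)),
        abs_of_nonneg (hZ0 ω)]
      exact mul_le_of_le_one_right (hZ0 ω) (hg1 ω))
  have hsplit : ∫ ω, Z ω ∂P ≤ a + ∫ ω, Z ω * g ω ∂P := by
    have hpt : ∀ ω, Z ω ≤ a + Z ω * g ω := fun ω => by
      by_cases h : ω ∈ {ω | a < Z ω}
      · rw [hg, indicator_of_mem h, mul_one]; linarith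
      · rw [hg, indicator_of_notMem h, mul_zero, add_zero]
        exact not_lt.1 h
    calc ∫ ω, Z ω ∂P ≤ ∫ ω, a + Z ω * g ω ∂P :=
          integral_mono hZi ((integrable_const a).add hZgi) hpt
      _ = a + ∫ ω, Z ω * g ω ∂P := by
          rw [integral_add (integrable_const a) hZgi, integral_const, probReal_univ, one_smul]
  rw [hgq] at hH
  linarith

/-- **Paley–Zygmund inequality with a moment of order `p > 1`.** On a probability space, for a
measurable `Z ≥ 0` with `Z^p` integrable, `p, q` Hölder conjugate and a level `0 ≤ a ≤ ∫ Z`: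
`((∫ Z - a) / (∫ Z^p)^{1/p})^q ≤ P{a < Z}`.
With `a = θ E Z`, `θ ∈ [0,1]`: `P(Z > θ E Z) ≥ ((1 - θ) E Z / ‖Z‖_p)^{p/(p-1)}`; `p = q = 2` is the
classical inequality (Paley–Zygmund 1932; Kahane, *Some random series of functions*, Ch. I §6).
[folklore] -/
theorem paleyZygmund_rpow [IsProbabilityMeasure P] {Z : Ω → ℝ}
    (hZ0 : ∀ ω, 0 ≤ Z ω) (hZm : Measurable Z) {p q : ℝ} (hpq : p.HolderConjugate q)
    (hZp : Integrable (fun ω => Z ω ^ p) P) {a : ℝ} (ha : 0 ≤ a) (hle : a ≤ ∫ ω, Z ω ∂P) :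
    ((∫ ω, Z ω ∂P - a) / (∫ ω, Z ω ^ p ∂P) ^ (1 / p)) ^ q ≤ P.real {ω | a < Z ω} := by
  have hq0 : 0 < q := hpq.symm.pos
  have h := integral_sub_le_rpow_mul_measureReal_rpow hZ0 hZm hpq hZp ha
  set N : ℝ := (∫ ω, Z ω ^ p ∂P) ^ (1 / p) with hN
  have hN0 : 0 ≤ N := Real.rpow_nonneg (integral_nonneg fun ω => Real.rpow_nonneg (hZ0 ω) _) _
  have hρ0 : 0 ≤ P.real {ω | a < Z ω} := measureReal_nonneg
  rcases hN0.eq_or_lt with hN' | hN'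
  · rw [← hN', div_zero, Real.zero_rpow hq0.ne']
    exact hρ0
  · have h1 : (∫ ω, Z ω ∂P - a) / N ≤ P.real {ω | a < Z ω} ^ (1 / q) := by
      rw [div_le_iff₀ hN', mul_comm]; exact h
    have h2 := Real.rpow_le_rpow (div_nonneg (sub_nonneg.2 hle) hN0) h1 hq0.le
    rwa [← Real.rpow_mul hρ0, one_div_mul_cancel hq0.ne', Real.rpow_one] at h2

end Literature.Probability.Moments

end
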